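import Literature.NumberTheory.Sieve.HeathBrownCubicEmbeddingVolume
import Mathlib.MeasureTheory.Function.JacobianOneDim
import Mathlib.Analysis.SpecialFunctions.Integrals.Basic
import Mathlib.MeasureTheory.Measure.Lebesgue.Complex
import HarnessLib

/-!
# Heath-Brown 2001 (PLMS), §8: `∫ dx/N(x)` over a general norm–unit–angle box
# `= (φ₂ − φ₁) log(N₂/N₁) log(ν₂/ν₁)/(6√3)`

Topic `Literature/NumberTheory/Sieve`; a PROVED analytic layer (definitions with bodies, no named facts)
under the named fact `Irving2015_largestPrimeFactor_cubic` (`LargestPrimeFactorCubic.lean`), the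
parametric form of `LargestPrimeFactorCubicVolume.lean` (`regionVolume_eq`, the value of Heath-Brown's
`I₂`).  Source: D. R. Heath-Brown, *The largest prime factor of `X³ + 2`*, Proc. London Math. Soc. (3)
82 (2001) 554–596, §8 pp. 31–34 of the held text.  There the main term needs not only `I₂` but the
comparison `I₂ − I₁ ≪ X^{−δ/6}` ((8.10)–(8.14)): the points of `𝓡₂` not covered by good cubes lie in
thin shells at the ends of the norm range, of the unit window and of the angular sector
("`μ = X^{1+2δ} + O(X^{1+5δ/3})`", "the variable `ν` is restricted to an interval of length
`O(X^{−δ/6})`", "the variable `θ` is restricted to lie in an interval of length `O(X^{−δ/6})`", p. 34).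
For the LOWER bound `I₁ ≥ (1 − o(1)) I₂` it suffices to integrate over a slightly SHRUNK box in
Heath-Brown's coordinates `(μ, ν, θ) = (N(x), σ₁(x)/N(x)^{1/3}, arg v(x))` (p. 32), whose volume is
given by the same closed formula; this file PROVES that formula for arbitrary parameters:

  **`genVolume_eq`**: for `0 < N₁ ≤ N₂`, `0 < ν₁ ≤ ν₂`, `−π ≤ φ₁ ≤ φ₂ ≤ π`,
  `∫_{N₁ < N(x) < N₂, ν₁N^{1/3} < σ₁(x) < ν₂N^{1/3}, φ₁ < arg v(x) < φ₂} dx/N(x)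
     = (φ₂ − φ₁) · log(N₂/N₁) · log(ν₂/ν₁) / (6√3)`

("`∫ dx dy dz/N = (1/3√3) ∫ dw dr dθ/(wr)` … `I₂ = (π/6√3) ∫ dμ dν/(μν)`", p. 32; Heath-Brown's
`𝓡₂` is `ν ∈ (1, ε₀)`, `θ + 2π/3 ∈ (0, π)`).  The route is that of `…Volume.lean` (Minkowski map
`T`, `∫ F(Tx) dx = (3√3)⁻¹ ∫ F`, polar coordinates in `v`, the substitution `μ = wr²`, Fubini), with
the half-plane `x₁³ > 2x₂³` replaced by the sector `arg v ∈ (φ₁, φ₂)`.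

## References

* D. R. Heath-Brown, *The largest prime factor of `X³ + 2`*, Proc. London Math. Soc. (3) 82 (2001)
  554–596, §8 pp. 31–34 ((8.8)–(8.14), `I₁`, `I₂`). [`HeathBrown2001LargestPrimeFactorCubic`]

## Mathlib / tree search

Tree: `CubicSieve.embT`, `integral_comp_embT`, `ell`, `cplxEmb`, `ell_mul_normSq_cplxEmb`, `normForm`
(`HeathBrownCubicEmbeddingVolume` chain); `HeathBrown2001.regionVolume_eq` (the special case, sibling
file).  Mathlib: `integral_comp_polarCoord_symm`, `Complex.arg_mul_cos_add_sin_mul_I`,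
`Complex.measurable_arg`, `setIntegral_prod_mul`, `integral_image_eq_integral_abs_deriv_smul`,
`integral_integral_swap`, `Measure.integrableOn_of_bounded`, `integral_inv_of_pos`.
-/

noncomputable section

open MeasureTheory Set Filter Real

namespace Literature.NumberTheory.Sieve.HeathBrown2001

open CubicSieve

/-! ### The box and the integrand -/

/-- The angle of a point of `ℝ²` read as a complex number: `arg(p₁ + p₂ i)`. [folklore] -/
def argRP (p : ℝ × ℝ) : ℝ := Complex.arg ((p.1 : ℂ) + (p.2 : ℂ) * Complex.I)

/-- `argRP` is measurable. [folklore] -/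
theorem measurable_argRP : Measurable argRP := by
  unfold argRP
  exact Complex.measurable_arg.comp (by fun_prop)

/-- `argRP (Re v, Im v) = arg v`. [folklore] -/
theorem argRP_re_im (z : ℂ) : argRP (z.re, z.im) = Complex.arg z := by
  unfold argRP
  rw [Complex.re_add_im]

/-- The box `𝓑 = {x : N₁ < N(x) < N₂, ν₁N^{1/3} < σ₁(x) < ν₂N^{1/3}, φ₁ < arg v(x) < φ₂}` in Heath-Brown's
coordinates `(μ, ν, θ)` (p. 32). [cite: HeathBrown2001LargestPrimeFactorCubic, §8 p. 32] -/
def genRegion (ν₁ ν₂ φ₁ φ₂ N₁ N₂ : ℝ) : Set (ℝ × ℝ × ℝ) :=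
  {x | N₁ < normForm x ∧ normForm x < N₂ ∧ ν₁ * (normForm x) ^ ((1 : ℝ) / 3) < ell x ∧
    ell x < ν₂ * (normForm x) ^ ((1 : ℝ) / 3) ∧ Complex.arg (cplxEmb x) ∈ Set.Ioo φ₁ φ₂}

/-- The integrand `𝟙_𝓑(x)/N(x)`. [cite: HeathBrown2001LargestPrimeFactorCubic, §8 (I₁, I₂)] -/
def genIntegrand (ν₁ ν₂ φ₁ φ₂ N₁ N₂ : ℝ) (x : ℝ × ℝ × ℝ) : ℝ :=
  (genRegion ν₁ ν₂ φ₁ φ₂ N₁ N₂).indicator (fun x => (normForm x)⁻¹) x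

/-- `∫_𝓑 dx/N(x)`. [cite: HeathBrown2001LargestPrimeFactorCubic, §8 (I₁, I₂)] -/
def genVolume (ν₁ ν₂ φ₁ φ₂ N₁ N₂ : ℝ) : ℝ := ∫ x, genIntegrand ν₁ ν₂ φ₁ φ₂ N₁ N₂ x

/-- The norm–window condition in the coordinates `(w, μ)`: `N₁ < μ < N₂`, `ν₁μ^{1/3} < w < ν₂μ^{1/3}`. [folklore] -/
def GWCond (ν₁ ν₂ N₁ N₂ w μ : ℝ) : Prop :=
  N₁ < μ ∧ μ < N₂ ∧ ν₁ * μ ^ ((1 : ℝ) / 3) < w ∧ w < ν₂ * μ ^ ((1 : ℝ) / 3)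

open scoped Classical in
/-- The integrand in the coordinates `y = (w, Re v, Im v)`. [folklore] -/
def genG (ν₁ ν₂ φ₁ φ₂ N₁ N₂ : ℝ) (y : ℝ × ℝ × ℝ) : ℝ :=
  if GWCond ν₁ ν₂ N₁ N₂ y.1 (y.1 * (y.2.1 ^ 2 + y.2.2 ^ 2)) ∧ argRP y.2 ∈ Set.Ioo φ₁ φ₂ then
    (y.1 * (y.2.1 ^ 2 + y.2.2 ^ 2))⁻¹ else 0

section Params

variable {ν₁ ν₂ φ₁ φ₂ : ℝ}

/-! ### The pointwise identity `𝟙_𝓑/N = G ∘ T` -/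

/-- **`𝟙_𝓑(x)/N(x) = G(Tx)`** pointwise. [cite: HeathBrown2001LargestPrimeFactorCubic, §8 p. 32] -/
theorem genIntegrand_eq_genG (N₁ N₂ : ℝ) (x : ℝ × ℝ × ℝ) :
    genIntegrand ν₁ ν₂ φ₁ φ₂ N₁ N₂ x = genG ν₁ ν₂ φ₁ φ₂ N₁ N₂ (embT x) := by
  classical
  have hN : normForm x = ell x * ((cplxEmb x).re ^ 2 + (cplxEmb x).im ^ 2) := by
    rw [← ell_mul_normSq_cplxEmb, Complex.normSq_apply]; ring
  have harg : argRP ((cplxEmb x).re, (cplxEmb x).im) = Complex.arg (cplxEmb x) := argRP_re_im _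
  have hiff : x ∈ genRegion ν₁ ν₂ φ₁ φ₂ N₁ N₂ ↔
      (GWCond ν₁ ν₂ N₁ N₂ (ell x) (ell x * ((cplxEmb x).re ^ 2 + (cplxEmb x).im ^ 2)) ∧
        argRP ((cplxEmb x).re, (cplxEmb x).im) ∈ Set.Ioo φ₁ φ₂) := by
    rw [← hN, harg]
    simp only [genRegion, Set.mem_setOf_eq, GWCond, and_assoc]
  unfold genIntegrand genG
  simp only [embT_apply]
  by_cases h : x ∈ genRegion ν₁ ν₂ φ₁ φ₂ N₁ N₂
  · rw [Set.indicator_of_mem h, if_pos (hiff.1 h), ← hN]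
  · rw [Set.indicator_of_notMem h, if_neg (fun h' => h (hiff.2 h'))]

/-- Hence `∫_𝓑 dx/N = (3√3)⁻¹ ∫ G`. [cite: HeathBrown2001LargestPrimeFactorCubic, §8 p. 32] -/
theorem genVolume_eq_integral_genG (N₁ N₂ : ℝ) :
    genVolume ν₁ ν₂ φ₁ φ₂ N₁ N₂ = (3 * Real.sqrt 3)⁻¹ * ∫ y, genG ν₁ ν₂ φ₁ φ₂ N₁ N₂ y := by
  rw [genVolume, ← integral_comp_embT]
  exact integral_congr_ae (Eventually.of_forall fun x => genIntegrand_eq_genG N₁ N₂ x)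

/-! ### The angular integral -/

/-- `arg(r cos θ + i r sin θ) = θ` for `r > 0`, `θ ∈ (−π, π)`. [folklore] -/
theorem argRP_polar {r θ : ℝ} (hr : 0 < r) (hθ : θ ∈ Set.Ioo (-Real.pi) Real.pi) :
    argRP (r * Real.cos θ, r * Real.sin θ) = θ := by
  unfold argRP
  have : ((r * Real.cos θ : ℝ) : ℂ) + ((r * Real.sin θ : ℝ) : ℂ) * Complex.I =
      r * (Complex.cos θ + Complex.sin θ * Complex.I) := by push_cast; ring
  rw [this, Complex.arg_mul_cos_add_sin_mul_I hr ⟨hθ.1, hθ.2.le⟩]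

open scoped Classical in
/-- **The angular integral**: `∫_{−π}^{π} 𝟙[θ ∈ (φ₁, φ₂)] dθ = φ₂ − φ₁` for `−π ≤ φ₁ ≤ φ₂ ≤ π`.
[cite: HeathBrown2001LargestPrimeFactorCubic, §8 p. 32] -/
theorem integral_angle (hφ₁ : -Real.pi ≤ φ₁) (hφ : φ₁ ≤ φ₂) (hφ₂ : φ₂ ≤ Real.pi) :
    ∫ θ in Set.Ioo (-Real.pi) Real.pi, (if θ ∈ Set.Ioo φ₁ φ₂ then (1 : ℝ) else 0) = φ₂ - φ₁ := by
  have h1 : ∀ θ ∈ Set.Ioo (-Real.pi) Real.pi,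
      (if θ ∈ Set.Ioo φ₁ φ₂ then (1 : ℝ) else 0) = (Set.Ioo φ₁ φ₂).indicator (fun _ => (1 : ℝ)) θ := by
    intro θ _; rw [Set.indicator_apply]
  rw [setIntegral_congr_fun measurableSet_Ioo h1, setIntegral_indicator measurableSet_Ioo]
  have hset : Set.Ioo (-Real.pi) Real.pi ∩ Set.Ioo φ₁ φ₂ = Set.Ioo φ₁ φ₂ :=
    Set.inter_eq_right.mpr (Set.Ioo_subset_Ioo hφ₁ hφ₂)
  rw [hset, setIntegral_congr_set Ioo_ae_eq_Ioc, ← intervalIntegral.integral_of_le hφ,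
    intervalIntegral.integral_const, smul_eq_mul, mul_one]

/-! ### Polar coordinates in `v` -/

open scoped Classical in
/-- The radial integrand `R(w, r) = 𝟙[GWCond(w, wr²)]/(wr)`. [folklore] -/
def genRad (ν₁ ν₂ N₁ N₂ w r : ℝ) : ℝ := if GWCond ν₁ ν₂ N₁ N₂ w (w * r ^ 2) then (w * r)⁻¹ else 0

open scoped Classical in
/-- The integrand after `μ = wr²`: `K(w, μ) = 𝟙[GWCond(w, μ)]/(2wμ)`. [folklore] -/
def genK (ν₁ ν₂ N₁ N₂ w μ : ℝ) : ℝ := if GWCond ν₁ ν₂ N₁ N₂ w μ then (2 * w * μ)⁻¹ else 0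

/-- `GWCond` forces `0 < μ` and `0 < w` (for `N₁ ≥ 0`, `ν₁ ≥ 0`). [folklore] -/
theorem GWCond.pos {N₁ N₂ w μ : ℝ} (hN₁ : 0 ≤ N₁) (hν₁ : 0 ≤ ν₁) (h : GWCond ν₁ ν₂ N₁ N₂ w μ) :
    0 < μ ∧ 0 < w := by
  obtain ⟨h1, -, h3, -⟩ := h
  have hμ : 0 < μ := lt_of_le_of_lt hN₁ h1
  have : 0 ≤ ν₁ * μ ^ ((1 : ℝ) / 3) := mul_nonneg hν₁ (Real.rpow_nonneg hμ.le _)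
  exact ⟨hμ, by linarith⟩

open scoped Classical in
/-- **Polar coordinates**: `∫_v G(w, v) dv = (∫_{r>0} R(w, r) dr) · (φ₂ − φ₁)`.
[cite: HeathBrown2001LargestPrimeFactorCubic, §8 p. 32] -/
theorem integral_genG_snd {N₁ : ℝ} (hN₁ : 0 ≤ N₁) (hν₁ : 0 ≤ ν₁) (hφ₁ : -Real.pi ≤ φ₁) (hφ : φ₁ ≤ φ₂)
    (hφ₂ : φ₂ ≤ Real.pi) (N₂ w : ℝ) :
    ∫ p : ℝ × ℝ, genG ν₁ ν₂ φ₁ φ₂ N₁ N₂ (w, p) = (∫ r in Ioi (0 : ℝ), genRad ν₁ ν₂ N₁ N₂ w r) * (φ₂ - φ₁) := by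
  rw [← integral_comp_polarCoord_symm]
  have key : ∀ q ∈ polarCoord.target, q.1 • genG ν₁ ν₂ φ₁ φ₂ N₁ N₂ (w, polarCoord.symm q) =
      genRad ν₁ ν₂ N₁ N₂ w q.1 * (if q.2 ∈ Set.Ioo φ₁ φ₂ then (1 : ℝ) else 0) := by
    rintro ⟨r, θ⟩ ⟨hr, hθ⟩
    simp only [Set.mem_Ioi] at hr
    have h1 : (r * Real.cos θ) ^ 2 + (r * Real.sin θ) ^ 2 = r ^ 2 := by
      nlinarith [Real.cos_sq_add_sin_sq θ]
    have h2 : argRP (r * Real.cos θ, r * Real.sin θ) = θ := argRP_polar hr hθ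
    simp only [polarCoord_symm_apply, smul_eq_mul, genG, genRad, h1, h2]
    by_cases hW : GWCond ν₁ ν₂ N₁ N₂ w (w * r ^ 2)
    · have hw : 0 < w := (GWCond.pos hN₁ hν₁ hW).2
      by_cases hA : θ ∈ Set.Ioo φ₁ φ₂
      · rw [if_pos ⟨hW, hA⟩, if_pos hW, if_pos hA]
        field_simp
      · rw [if_neg (fun h => hA h.2), if_pos hW, if_neg hA]; ring
    · rw [if_neg (fun h => hW h.1), if_neg hW]; ring
  rw [setIntegral_congr_fun polarCoord.open_target.measurableSet key,
    show polarCoord.target = Set.Ioi (0 : ℝ) ×ˢ Set.Ioo (-Real.pi) Real.pi from rfl,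
    Measure.volume_eq_prod,
    setIntegral_prod_mul (fun r : ℝ => genRad ν₁ ν₂ N₁ N₂ w r)
      (fun θ : ℝ => if θ ∈ Set.Ioo φ₁ φ₂ then (1 : ℝ) else 0),
    integral_angle hφ₁ hφ hφ₂]

/-! ### The substitution `μ = w r²` -/

open scoped Classical in
/-- `∫_{r>0} R(w, r) dr = ∫_{μ>0} K(w, μ) dμ` for `w > 0`. [cite: HeathBrown2001LargestPrimeFactorCubic, §8 p. 32] -/
theorem integral_genRad_eq (N₁ N₂ : ℝ) {w : ℝ} (hw : 0 < w) :
    ∫ r in Ioi (0 : ℝ), genRad ν₁ ν₂ N₁ N₂ w r = ∫ μ in Ioi (0 : ℝ), genK ν₁ ν₂ N₁ N₂ w μ := by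
  have himage : (fun r : ℝ => w * r ^ 2) '' Ioi (0 : ℝ) = Ioi 0 := by
    ext μ
    constructor
    · rintro ⟨r, hr, rfl⟩
      exact mul_pos hw (pow_pos hr 2)
    · intro hμ
      refine ⟨Real.sqrt (μ / w), Real.sqrt_pos.mpr (div_pos hμ hw), ?_⟩
      simp only
      rw [Real.sq_sqrt (div_pos hμ hw).le]
      field_simp
  have hderiv : ∀ r ∈ Ioi (0 : ℝ),
      HasDerivWithinAt (fun r : ℝ => w * r ^ 2) (2 * w * r) (Ioi 0) r := by
    intro r _
    refine (((hasDerivAt_pow 2 r).const_mul w).hasDerivWithinAt).congr_deriv ?_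
    norm_num
    ring
  have hinj : InjOn (fun r : ℝ => w * r ^ 2) (Ioi 0) := by
    intro r hr r' hr' h
    simp only [Set.mem_Ioi] at hr hr'
    have h2 : r ^ 2 = r' ^ 2 := mul_left_cancel₀ hw.ne' h
    exact (pow_left_inj₀ hr.le hr'.le (by norm_num)).mp h2
  have h := integral_image_eq_integral_abs_deriv_smul measurableSet_Ioi hderiv hinj (genK ν₁ ν₂ N₁ N₂ w)
  rw [himage] at h
  rw [h]
  refine setIntegral_congr_fun measurableSet_Ioi (fun r hr => ?_)
  simp only [Set.mem_Ioi] at hr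
  simp only [genRad, genK, smul_eq_mul]
  split_ifs with hW
  · rw [abs_of_pos (by positivity)]
    field_simp
  · ring

/-- For `w ≤ 0` the radial integrand vanishes (`N₁, ν₁ ≥ 0`). [folklore] -/
theorem genRad_eq_zero_of_nonpos {N₁ N₂ w : ℝ} (hN₁ : 0 ≤ N₁) (hν₁ : 0 ≤ ν₁) (hw : w ≤ 0) (r : ℝ) :
    genRad ν₁ ν₂ N₁ N₂ w r = 0 := by
  classical
  unfold genRad
  rw [if_neg]
  intro h
  linarith [(GWCond.pos hN₁ hν₁ h).2]

/-- For `w ≤ 0`, `K(w, μ) = 0`. [folklore] -/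
theorem genK_eq_zero_of_nonpos {N₁ N₂ w : ℝ} (hN₁ : 0 ≤ N₁) (hν₁ : 0 ≤ ν₁) (hw : w ≤ 0) (μ : ℝ) :
    genK ν₁ ν₂ N₁ N₂ w μ = 0 := by
  classical
  unfold genK
  rw [if_neg]
  intro h
  linarith [(GWCond.pos hN₁ hν₁ h).2]

/-- `K(w, μ) = 0` unless `μ > 0`. [folklore] -/
theorem genK_eq_zero_of_mu_nonpos {N₁ N₂ μ : ℝ} (hN₁ : 0 ≤ N₁) (hν₁ : 0 ≤ ν₁) (hμ : μ ≤ 0) (w : ℝ) :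
    genK ν₁ ν₂ N₁ N₂ w μ = 0 := by
  classical
  unfold genK
  rw [if_neg]
  intro h
  linarith [(GWCond.pos hN₁ hν₁ h).1]

/-- The radial integral in `μ`, for every `w`. [cite: HeathBrown2001LargestPrimeFactorCubic, §8 p. 32] -/
theorem integral_genRad_eq_integral_genK {N₁ : ℝ} (hN₁ : 0 ≤ N₁) (hν₁ : 0 ≤ ν₁) (N₂ w : ℝ) :
    ∫ r in Ioi (0 : ℝ), genRad ν₁ ν₂ N₁ N₂ w r = ∫ μ, genK ν₁ ν₂ N₁ N₂ w μ := by
  rcases le_or_gt w 0 with hw | hw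
  · simp only [genRad_eq_zero_of_nonpos hN₁ hν₁ hw, genK_eq_zero_of_nonpos hN₁ hν₁ hw, integral_zero]
  · rw [integral_genRad_eq N₁ N₂ hw]
    exact setIntegral_eq_integral_of_forall_compl_eq_zero fun μ hμ =>
      genK_eq_zero_of_mu_nonpos hN₁ hν₁ (not_lt.mp hμ) w

/-! ### The inner and outer integrals -/

/-- `∫_w K(w, μ) dw = log(ν₂/ν₁)/(2μ)` for `N₁ < μ < N₂` (`N₁ > 0`, `0 < ν₁ ≤ ν₂`).
[cite: HeathBrown2001LargestPrimeFactorCubic, §8 p. 32] -/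
theorem integral_genK_fst {N₁ N₂ μ : ℝ} (hN₁ : 0 < N₁) (hν₁ : 0 < ν₁) (hν : ν₁ ≤ ν₂) (hμ : μ ∈ Ioo N₁ N₂) :
    ∫ w, genK ν₁ ν₂ N₁ N₂ w μ = Real.log (ν₂ / ν₁) / (2 * μ) := by
  classical
  have hμ0 : 0 < μ := hN₁.trans hμ.1
  set a : ℝ := ν₁ * μ ^ ((1 : ℝ) / 3) with ha
  set b : ℝ := ν₂ * μ ^ ((1 : ℝ) / 3) with hb
  have hc0 : 0 < μ ^ ((1 : ℝ) / 3) := Real.rpow_pos_of_pos hμ0 _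
  have ha0 : 0 < a := by rw [ha]; positivity
  have hab : a ≤ b := by rw [ha, hb]; exact mul_le_mul_of_nonneg_right hν hc0.le
  have hK : ∀ w, genK ν₁ ν₂ N₁ N₂ w μ = (Ioo a b).indicator (fun w => (2 * μ)⁻¹ * w⁻¹) w := by
    intro w
    by_cases h : w ∈ Ioo a b
    · rw [Set.indicator_of_mem h, genK, if_pos (show GWCond ν₁ ν₂ N₁ N₂ w μ from ⟨hμ.1, hμ.2, h.1, h.2⟩)]
      have hw0 : w ≠ 0 := (ha0.trans h.1).ne'
      field_simp
    · rw [Set.indicator_of_notMem h, genK, if_neg (fun hW => h ⟨hW.2.2.1, hW.2.2.2⟩)]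
  simp_rw [hK]
  rw [integral_indicator measurableSet_Ioo, setIntegral_congr_set Ioo_ae_eq_Ioc,
    ← intervalIntegral.integral_of_le hab, intervalIntegral.integral_const_mul,
    integral_inv_of_pos ha0 (ha0.trans_le hab)]
  have hba : b / a = ν₂ / ν₁ := by
    rw [hb, ha]; field_simp
  rw [hba]
  field_simp

/-- Off `(N₁, N₂)` the inner integral vanishes. [folklore] -/
theorem integral_genK_fst_eq_zero {N₁ N₂ μ : ℝ} (hμ : μ ∉ Ioo N₁ N₂) :
    ∫ w, genK ν₁ ν₂ N₁ N₂ w μ = 0 := by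
  classical
  have : ∀ w, genK ν₁ ν₂ N₁ N₂ w μ = 0 := by
    intro w
    unfold genK
    rw [if_neg]
    exact fun h => hμ ⟨h.1, h.2.1⟩
  simp only [this, integral_zero]

/-- `∫_μ ∫_w K = (log(ν₂/ν₁)/2) log(N₂/N₁)`. [cite: HeathBrown2001LargestPrimeFactorCubic, §8 pp. 32–33] -/
theorem integral_integral_genK {N₁ N₂ : ℝ} (hN₁ : 0 < N₁) (hN : N₁ ≤ N₂) (hν₁ : 0 < ν₁) (hν : ν₁ ≤ ν₂) :
    ∫ μ, ∫ w, genK ν₁ ν₂ N₁ N₂ w μ = Real.log (ν₂ / ν₁) / 2 * Real.log (N₂ / N₁) := by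
  have h1 : ∀ μ, ∫ w, genK ν₁ ν₂ N₁ N₂ w μ =
      (Ioo N₁ N₂).indicator (fun μ => Real.log (ν₂ / ν₁) / 2 * μ⁻¹) μ := by
    intro μ
    rw [Set.indicator_apply]
    by_cases hμ : μ ∈ Ioo N₁ N₂
    · rw [if_pos hμ, integral_genK_fst hN₁ hν₁ hν hμ]
      have : (0 : ℝ) < μ := hN₁.trans hμ.1
      field_simp
    · rw [if_neg hμ, integral_genK_fst_eq_zero hμ]
  simp_rw [h1]
  rw [integral_indicator measurableSet_Ioo, setIntegral_congr_set Ioo_ae_eq_Ioc,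
    ← intervalIntegral.integral_of_le hN, intervalIntegral.integral_const_mul,
    integral_inv_of_pos hN₁ (hN₁.trans_le hN)]

/-! ### Integrability -/

/-- The condition set of `G` is measurable. [folklore] -/
theorem measurableSet_genG_cond (N₁ N₂ : ℝ) :
    MeasurableSet {y : ℝ × ℝ × ℝ | GWCond ν₁ ν₂ N₁ N₂ y.1 (y.1 * (y.2.1 ^ 2 + y.2.2 ^ 2)) ∧
      argRP y.2 ∈ Set.Ioo φ₁ φ₂} := by
  have hμ : Measurable fun y : ℝ × ℝ × ℝ => y.1 * (y.2.1 ^ 2 + y.2.2 ^ 2) :=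
    measurable_fst.mul ((measurable_snd.fst.pow_const 2).add (measurable_snd.snd.pow_const 2))
  have hc : Measurable fun y : ℝ × ℝ × ℝ => (y.1 * (y.2.1 ^ 2 + y.2.2 ^ 2)) ^ ((1 : ℝ) / 3) :=
    hμ.pow_const _
  have h1 : MeasurableSet {y : ℝ × ℝ × ℝ | N₁ < y.1 * (y.2.1 ^ 2 + y.2.2 ^ 2)} :=
    measurableSet_lt measurable_const hμ
  have h2 : MeasurableSet {y : ℝ × ℝ × ℝ | y.1 * (y.2.1 ^ 2 + y.2.2 ^ 2) < N₂} :=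
    measurableSet_lt hμ measurable_const
  have h3 : MeasurableSet {y : ℝ × ℝ × ℝ | ν₁ * (y.1 * (y.2.1 ^ 2 + y.2.2 ^ 2)) ^ ((1 : ℝ) / 3) < y.1} :=
    measurableSet_lt (hc.const_mul _) measurable_fst
  have h4 : MeasurableSet {y : ℝ × ℝ × ℝ | y.1 < ν₂ * (y.1 * (y.2.1 ^ 2 + y.2.2 ^ 2)) ^ ((1 : ℝ) / 3)} :=
    measurableSet_lt measurable_fst (hc.const_mul _)
  have h5 : MeasurableSet {y : ℝ × ℝ × ℝ | argRP y.2 ∈ Set.Ioo φ₁ φ₂} :=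
    (measurable_argRP.comp measurable_snd) measurableSet_Ioo
  simp only [GWCond, Set.setOf_and]
  exact (h1.inter (h2.inter (h3.inter h4))).inter h5

open scoped Classical in
/-- `G` is measurable. [folklore] -/
theorem measurable_genG (N₁ N₂ : ℝ) : Measurable (genG ν₁ ν₂ φ₁ φ₂ N₁ N₂) := by
  have hμ : Measurable fun y : ℝ × ℝ × ℝ => y.1 * (y.2.1 ^ 2 + y.2.2 ^ 2) :=
    measurable_fst.mul ((measurable_snd.fst.pow_const 2).add (measurable_snd.snd.pow_const 2))
  unfold genG
  exact Measurable.ite (measurableSet_genG_cond N₁ N₂) hμ.inv measurable_const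

/-- The bounds implied by `GWCond`: `w ∈ [ν₁N₁^{1/3}, ν₂N₂^{1/3}]`, `|v|² ≤ N₂/(ν₁N₁^{1/3})`, `1/(w|v|²) ≤ N₁⁻¹`.
[folklore] -/
theorem genG_bounds {N₁ N₂ : ℝ} (hN₁ : 0 < N₁) (hν₁ : 0 < ν₁) (hν : ν₁ ≤ ν₂) {y : ℝ × ℝ × ℝ}
    (h : GWCond ν₁ ν₂ N₁ N₂ y.1 (y.1 * (y.2.1 ^ 2 + y.2.2 ^ 2))) :
    ν₁ * N₁ ^ ((1 : ℝ) / 3) ≤ y.1 ∧ y.1 ≤ ν₂ * N₂ ^ ((1 : ℝ) / 3) ∧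
      y.2.1 ^ 2 + y.2.2 ^ 2 ≤ N₂ / (ν₁ * N₁ ^ ((1 : ℝ) / 3)) ∧
      (y.1 * (y.2.1 ^ 2 + y.2.2 ^ 2))⁻¹ ≤ N₁⁻¹ := by
  obtain ⟨hμ0, hw0⟩ := GWCond.pos hN₁.le hν₁.le h
  obtain ⟨h1, h2, h3, h4⟩ := h
  set μ := y.1 * (y.2.1 ^ 2 + y.2.2 ^ 2) with hμ
  have hc1 : N₁ ^ ((1 : ℝ) / 3) ≤ μ ^ ((1 : ℝ) / 3) := Real.rpow_le_rpow hN₁.le h1.le (by norm_num)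
  have hc2 : μ ^ ((1 : ℝ) / 3) ≤ N₂ ^ ((1 : ℝ) / 3) := Real.rpow_le_rpow hμ0.le h2.le (by norm_num)
  have hN₁c : 0 < N₁ ^ ((1 : ℝ) / 3) := Real.rpow_pos_of_pos hN₁ _
  have hw1 : ν₁ * N₁ ^ ((1 : ℝ) / 3) ≤ y.1 := by nlinarith
  have hν₂ : 0 ≤ ν₂ := hν₁.le.trans hν
  have hw2 : y.1 ≤ ν₂ * N₂ ^ ((1 : ℝ) / 3) := by nlinarith
  refine ⟨hw1, hw2, ?_, ?_⟩
  · rw [le_div_iff₀ (by positivity)]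
    have hq : 0 ≤ y.2.1 ^ 2 + y.2.2 ^ 2 := by positivity
    calc (y.2.1 ^ 2 + y.2.2 ^ 2) * (ν₁ * N₁ ^ ((1 : ℝ) / 3)) ≤ (y.2.1 ^ 2 + y.2.2 ^ 2) * y.1 :=
          mul_le_mul_of_nonneg_left hw1 hq
      _ = μ := by rw [hμ]; ring
      _ ≤ N₂ := h2.le
  · exact inv_anti₀ hN₁ h1.le

open scoped Classical in
/-- **`G` is integrable**. [folklore] -/
theorem integrable_genG {N₁ N₂ : ℝ} (hN₁ : 0 < N₁) (hν₁ : 0 < ν₁) (hν : ν₁ ≤ ν₂) :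
    Integrable (genG ν₁ ν₂ φ₁ φ₂ N₁ N₂) := by
  set w₁ : ℝ := ν₁ * N₁ ^ ((1 : ℝ) / 3)
  set w₂ : ℝ := ν₂ * N₂ ^ ((1 : ℝ) / 3)
  set P : ℝ := Real.sqrt (N₂ / (ν₁ * N₁ ^ ((1 : ℝ) / 3)))
  set Box : Set (ℝ × ℝ × ℝ) := Set.Icc w₁ w₂ ×ˢ (Set.Icc (-P) P ×ˢ Set.Icc (-P) P) with hBox
  have hsupp : Function.support (genG ν₁ ν₂ φ₁ φ₂ N₁ N₂) ⊆ Box := by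
    intro y hy
    rw [Function.mem_support] at hy
    have hcond : GWCond ν₁ ν₂ N₁ N₂ y.1 (y.1 * (y.2.1 ^ 2 + y.2.2 ^ 2)) ∧ argRP y.2 ∈ Set.Ioo φ₁ φ₂ := by
      by_contra hc
      exact hy (by rw [genG, if_neg hc])
    obtain ⟨hw1, hw2, hq, -⟩ := genG_bounds hN₁ hν₁ hν hcond.1
    have hP2 : P ^ 2 = N₂ / (ν₁ * N₁ ^ ((1 : ℝ) / 3)) := by
      refine Real.sq_sqrt (div_nonneg ?_ (by positivity))
      have := hcond.1.2.1
      have := (GWCond.pos hN₁.le hν₁.le hcond.1).1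
      linarith
    have ha : y.2.1 ∈ Set.Icc (-P) P := by
      rw [Set.mem_Icc, ← abs_le]
      apply abs_le_of_sq_le_sq _ (Real.sqrt_nonneg _)
      rw [hP2]; nlinarith [sq_nonneg y.2.2]
    have hc : y.2.2 ∈ Set.Icc (-P) P := by
      rw [Set.mem_Icc, ← abs_le]
      apply abs_le_of_sq_le_sq _ (Real.sqrt_nonneg _)
      rw [hP2]; nlinarith [sq_nonneg y.2.1]
    exact ⟨⟨hw1, hw2⟩, ha, hc⟩
  rw [← integrableOn_iff_integrable_of_support_subset hsupp]
  have hfin : volume Box ≠ ⊤ := by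
    rw [hBox, Measure.volume_eq_prod, Measure.prod_prod, Measure.volume_eq_prod, Measure.prod_prod]
    simp [Real.volume_Icc, ENNReal.mul_eq_top]
  refine Measure.integrableOn_of_bounded hfin (measurable_genG N₁ N₂).aestronglyMeasurable (M := N₁⁻¹) ?_
  refine Filter.Eventually.of_forall fun y => ?_
  rw [Real.norm_eq_abs, genG]
  split_ifs with h
  · have hμ := (GWCond.pos hN₁.le hν₁.le h.1).1
    rw [abs_of_pos (inv_pos.mpr hμ)]
    exact (genG_bounds hN₁ hν₁ hν h.1).2.2.2
  · rw [abs_zero]; positivity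

open scoped Classical in
/-- `K` is measurable on `ℝ²`. [folklore] -/
theorem measurable_genK (N₁ N₂ : ℝ) :
    Measurable (Function.uncurry fun w μ : ℝ => genK ν₁ ν₂ N₁ N₂ w μ) := by
  have hc : Measurable fun p : ℝ × ℝ => p.2 ^ ((1 : ℝ) / 3) := measurable_snd.pow_const _
  have h1 : MeasurableSet {p : ℝ × ℝ | N₁ < p.2} := measurableSet_lt measurable_const measurable_snd
  have h2 : MeasurableSet {p : ℝ × ℝ | p.2 < N₂} := measurableSet_lt measurable_snd measurable_const
  have h3 : MeasurableSet {p : ℝ × ℝ | ν₁ * p.2 ^ ((1 : ℝ) / 3) < p.1} :=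
    measurableSet_lt (hc.const_mul _) measurable_fst
  have h4 : MeasurableSet {p : ℝ × ℝ | p.1 < ν₂ * p.2 ^ ((1 : ℝ) / 3)} :=
    measurableSet_lt measurable_fst (hc.const_mul _)
  have hset : MeasurableSet {p : ℝ × ℝ | GWCond ν₁ ν₂ N₁ N₂ p.1 p.2} := by
    simp only [GWCond, Set.setOf_and]
    exact h1.inter (h2.inter (h3.inter h4))
  have hf : Measurable fun p : ℝ × ℝ => (2 * p.1 * p.2)⁻¹ :=
    ((measurable_fst.const_mul 2).mul measurable_snd).inv
  have : (Function.uncurry fun w μ : ℝ => genK ν₁ ν₂ N₁ N₂ w μ) =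
      fun p : ℝ × ℝ => if GWCond ν₁ ν₂ N₁ N₂ p.1 p.2 then (2 * p.1 * p.2)⁻¹ else 0 := by
    funext p; rfl
  rw [this]
  exact Measurable.ite hset hf measurable_const

open scoped Classical in
/-- **`K` is integrable on `ℝ²`**. [folklore] -/
theorem integrable_genK {N₁ N₂ : ℝ} (hN₁ : 0 < N₁) (hν₁ : 0 < ν₁) (hν : ν₁ ≤ ν₂) :
    Integrable (Function.uncurry fun w μ : ℝ => genK ν₁ ν₂ N₁ N₂ w μ) (volume.prod volume) := by
  set w₁ : ℝ := ν₁ * N₁ ^ ((1 : ℝ) / 3) with hw₁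
  set w₂ : ℝ := ν₂ * N₂ ^ ((1 : ℝ) / 3)
  set Box : Set (ℝ × ℝ) := Set.Icc w₁ w₂ ×ˢ Set.Icc N₁ N₂ with hBox
  have hN₁c : 0 < N₁ ^ ((1 : ℝ) / 3) := Real.rpow_pos_of_pos hN₁ _
  have hw₁0 : 0 < w₁ := by rw [hw₁]; positivity
  have hsupp : Function.support (Function.uncurry fun w μ : ℝ => genK ν₁ ν₂ N₁ N₂ w μ) ⊆ Box := by
    rintro ⟨w, μ⟩ hy
    rw [Function.mem_support, Function.uncurry_apply_pair] at hy
    have hcond : GWCond ν₁ ν₂ N₁ N₂ w μ := by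
      by_contra hc
      exact hy (by rw [genK, if_neg hc])
    have hb := genG_bounds (ν₂ := ν₂) hN₁ hν₁ hν (y := (w, Real.sqrt (μ / w), 0)) (by
      have hw : 0 < w := (GWCond.pos hN₁.le hν₁.le hcond).2
      have hμ : 0 < μ := (GWCond.pos hN₁.le hν₁.le hcond).1
      simp only
      rw [Real.sq_sqrt (div_pos hμ hw).le]
      have : w * (μ / w + 0 ^ 2) = μ := by field_simp; ring
      rw [this]; exact hcond)
    simp only at hb
    exact ⟨⟨hb.1, hb.2.1⟩, hcond.1.le, hcond.2.1.le⟩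
  have hmeas := measurable_genK (ν₁ := ν₁) (ν₂ := ν₂) N₁ N₂
  rw [← Measure.volume_eq_prod, ← integrableOn_iff_integrable_of_support_subset hsupp]
  have hfin : volume Box ≠ ⊤ := by
    rw [hBox, Measure.volume_eq_prod, Measure.prod_prod]
    simp [Real.volume_Icc, ENNReal.mul_eq_top]
  refine Measure.integrableOn_of_bounded hfin hmeas.aestronglyMeasurable (M := (2 * w₁ * N₁)⁻¹) ?_
  refine Filter.Eventually.of_forall fun p => ?_
  obtain ⟨w, μ⟩ := p
  rw [Real.norm_eq_abs, Function.uncurry_apply_pair, genK]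
  split_ifs with h
  · obtain ⟨hμ0, hw0⟩ := GWCond.pos hN₁.le hν₁.le h
    have hc1 : N₁ ^ ((1 : ℝ) / 3) ≤ μ ^ ((1 : ℝ) / 3) := Real.rpow_le_rpow hN₁.le h.1.le (by norm_num)
    have hww : w₁ ≤ w := by rw [hw₁]; nlinarith [h.2.2.1]
    rw [abs_of_pos (by positivity)]
    exact inv_anti₀ (by positivity) (by nlinarith [h.1])
  · rw [abs_zero]; positivity

/-! ### Assembly -/

/-- `∫ G = (φ₂ − φ₁) · (log(ν₂/ν₁)/2) · log(N₂/N₁)`. [cite: HeathBrown2001LargestPrimeFactorCubic, §8 pp. 32–33] -/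
theorem integral_genG {N₁ N₂ : ℝ} (hN₁ : 0 < N₁) (hN : N₁ ≤ N₂) (hν₁ : 0 < ν₁) (hν : ν₁ ≤ ν₂)
    (hφ₁ : -Real.pi ≤ φ₁) (hφ : φ₁ ≤ φ₂) (hφ₂ : φ₂ ≤ Real.pi) :
    ∫ y, genG ν₁ ν₂ φ₁ φ₂ N₁ N₂ y = (φ₂ - φ₁) * (Real.log (ν₂ / ν₁) / 2 * Real.log (N₂ / N₁)) := by
  have hint := integrable_genG (φ₁ := φ₁) (φ₂ := φ₂) (N₂ := N₂) hN₁ hν₁ hν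
  rw [Measure.volume_eq_prod] at hint ⊢
  rw [integral_prod _ hint]
  simp_rw [integral_genG_snd hN₁.le hν₁.le hφ₁ hφ hφ₂ N₂, integral_genRad_eq_integral_genK hN₁.le hν₁.le N₂]
  rw [integral_mul_const, integral_integral_swap (integrable_genK (N₂ := N₂) hN₁ hν₁ hν),
    integral_integral_genK hN₁ hN hν₁ hν]
  ring

/-- **The volume of a norm–unit–angle box**: for `0 < N₁ ≤ N₂`, `0 < ν₁ ≤ ν₂`, `−π ≤ φ₁ ≤ φ₂ ≤ π`,
`∫_{N₁<N(x)<N₂, ν₁N^{1/3}<σ₁(x)<ν₂N^{1/3}, φ₁<arg v(x)<φ₂} dx/N(x) = (φ₂ − φ₁) log(N₂/N₁) log(ν₂/ν₁)/(6√3)`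
(Heath-Brown's `(1/3√3)∫ dw dr dθ/(wr) = (1/6√3)∫ dμ dν dθ/(μν)`, p. 32).
[cite: HeathBrown2001LargestPrimeFactorCubic, §8 p. 32] -/
theorem genVolume_eq {N₁ N₂ : ℝ} (hN₁ : 0 < N₁) (hN : N₁ ≤ N₂) (hν₁ : 0 < ν₁) (hν : ν₁ ≤ ν₂)
    (hφ₁ : -Real.pi ≤ φ₁) (hφ : φ₁ ≤ φ₂) (hφ₂ : φ₂ ≤ Real.pi) :
    genVolume ν₁ ν₂ φ₁ φ₂ N₁ N₂ =
      (φ₂ - φ₁) * Real.log (N₂ / N₁) * Real.log (ν₂ / ν₁) / (6 * Real.sqrt 3) := by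
  rw [genVolume_eq_integral_genG, integral_genG hN₁ hN hν₁ hν hφ₁ hφ hφ₂]
  have h3 : Real.sqrt 3 ≠ 0 := (Real.sqrt_pos.mpr (by norm_num)).ne'
  field_simp
  ring

/-- The integrand is nonnegative (for `N₁ ≥ 0`); monotone use downstream. [folklore] -/
theorem genIntegrand_nonneg {N₁ N₂ : ℝ} (hN₁ : 0 ≤ N₁) (x : ℝ × ℝ × ℝ) : 0 ≤ genIntegrand ν₁ ν₂ φ₁ φ₂ N₁ N₂ x := by
  unfold genIntegrand
  by_cases h : x ∈ genRegion ν₁ ν₂ φ₁ φ₂ N₁ N₂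
  · rw [Set.indicator_of_mem h]; exact inv_nonneg.mpr (hN₁.trans h.1.le)
  · rw [Set.indicator_of_notMem h]

end Params

end Literature.NumberTheory.Sieve.HeathBrown2001
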